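import Summits.AtomisticToContinuum.FouriersLaw.Theorems.HonestZwanzigOrthogonalOhmBracketInductionFD

/-!
# HonestZwanzig / OrthogonalOhm — bracket induction, part 2: the induction (line `Sketch`, stub F3)

Support file for crux item `stmt-AtomisticToContinuum-12693` (`HonestZwanzig.OrthogonalOhm`), registered stub
`stub_bracketInduction` (F3) of skeleton v5.  The analytic half of the F-programme produces a smooth solution `v` of
the Poisson equation `L v = −(u − m)` for an energy profile `u = Σ ξ_x e_x` whose asymptotic variance vanishes, with
`∂_{p_0} v ≡ 0` (degenerate left-bath Dirichlet form).  This file proves the ALGEBRAIC half (any pinning, coupling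
`V(r) = r²/2 + βr⁴/4` with `β ≥ 0`, any bath temperatures):

* `stage_p` — `∂_{p_x} v ≡ 0` ⇒ `ξ_x = 0` and `∂_{q_x} v ≡ 0` (`L v` is affine in `p_x` with slope `∂_{q_x}v`,
  the right side is `−ξ_x p_x²/2 + …`);
* `stage_q` — if `v` ignores `q_y` and `∂_{p_i}v ≡ 0`, `ξ_i = 0` for `i ≤ y` then `ξ_{y+1} = 0` and
  `∂_{p_{y+1}} v ≡ 0` (parity of `V`, `V'` at `r = ±1`);
* `bracketInduction` / `stub_bracketInduction` — `∂_{p_0} v ≡ 0` and `L v = −(Σ ξ_x e_x − m)` force `ξ = 0`.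
Only the LEFT bath enters (through the hypothesis `∂_{p_0}v ≡ 0`).
-/

noncomputable section

open Function Finset
open Literature.MathematicalPhysics.KineticTheory.HeatConduction
open Literature.Barriers.AtomisticToContinuum

namespace Summit.AtomisticToContinuum.FouriersLaw.Theorems.HonestZwanzig

namespace OrthogonalOhmLine.BracketInduction

variable {N : ℕ}

/-! ### The two stages of the induction -/

section Stages

variable {ω₂ lam β γ T_L T_R : ℝ} (hβ : 0 ≤ β) {v : PhaseSpace N → ℝ} (hv : Differentiable ℝ v)
  {e : Fin N → PhaseSpace N → ℝ}
  (he : ∀ x z, e x z = z.2 x ^ 2 / 2 + (pinnedChain ω₂ lam β γ).U (z.1 x) +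
    ∑ j : Fin N, ((if j.val = x.val + 1 then (pinnedChain ω₂ lam β γ).V (z.1 j - z.1 x) / 2 else 0) +
      (if x.val = j.val + 1 then (pinnedChain ω₂ lam β γ).V (z.1 x - z.1 j) / 2 else 0)))
  {ξ : Fin N → ℝ} {m : ℝ}
  (hL : ∀ z, (pinnedChain ω₂ lam β γ).generator N T_L T_R v z = -((∑ x, ξ x * e x z) - m))

include hv he hL in
/-- **From `p_x`-invariance to `∂_{q_x} v ≡ 0` and `ξ_x = 0`.**  If `∂_{p_x} v ≡ 0` then `L v` is affine in
`p_x` with slope `∂_{q_x} v` while the right side is `-ξ_x p_x²/2 + const`. -/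
theorem stage_p (x : Fin N) (hpx : ∀ z, partialP x v z = 0) :
    ξ x = 0 ∧ ∀ z, partialQ x v z = 0 := by
  have hU := (pinnedChain_contDiff_U ω₂ lam β γ (n := 1)).differentiable one_ne_zero
  have hV := (pinnedChain_contDiff_V ω₂ lam β γ (n := 1)).differentiable one_ne_zero
  have hInv : ∀ z s, v (z.1, update z.2 x s) = v z := pLine_const hv x hpx
  -- the finite-difference identity `(s - p_x) ∂_{q_x} v = -ξ_x (s² - p_x²)/2`
  have key : ∀ (z : PhaseSpace N) (s : ℝ),
      (s - z.2 x) * partialQ x v z = -(ξ x * ((s ^ 2 - z.2 x ^ 2) / 2)) := by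
    intro z s
    have h1 := hL (z.1, update z.2 x s)
    rw [generator_pVar _ hU hV T_L T_R hInv z s, hL z, sum_e_pVar _ he ξ x z s] at h1
    linarith
  have hξ : ξ x = 0 := by
    classical
    -- at the point `0` with `s = 1, 2`
    have h1 := key ((0 : PhaseSpace N)) 1
    have h2 := key ((0 : PhaseSpace N)) 2
    simp only [Prod.snd_zero, Pi.zero_apply] at h1 h2
    nlinarith
  refine ⟨hξ, fun z => ?_⟩
  have h1 := key z (z.2 x + 1)
  rw [hξ] at h1
  simp only [zero_mul, neg_zero, add_sub_cancel_left, one_mul] at h1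
  exact h1

include hβ hv he hL in
/-- **The inductive step.**  If `v` ignores `q_y` and `∂_{p_i} v ≡ 0`, `ξ_i = 0` for all `i ≤ y`, then
`ξ_{y+1} = 0` and `∂_{p_{y+1}} v ≡ 0` (parity of `V`, `V'` at `r = ±1`). -/
theorem stage_q {y : Fin N} (hy : y.val + 1 < N) (hqy : ∀ z, partialQ y v z = 0)
    (hPle : ∀ i : Fin N, i.val ≤ y.val → ∀ z, partialP i v z = 0)
    (hξ : ∀ i : Fin N, i.val ≤ y.val → ξ i = 0) :
    ξ ⟨y.val + 1, hy⟩ = 0 ∧ ∀ z, partialP ⟨y.val + 1, hy⟩ v z = 0 := by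
  have hU := (pinnedChain_contDiff_U ω₂ lam β γ (n := 1)).differentiable one_ne_zero
  have hV := (pinnedChain_contDiff_V ω₂ lam β γ (n := 1)).differentiable one_ne_zero
  have hInv : ∀ z s, v (update z.1 y s, z.2) = v z := qLine_const hv y hqy
  have hVdef : ∀ r, (pinnedChain ω₂ lam β γ).V r = r ^ 2 / 2 + β * r ^ 4 / 4 := fun r => rfl
  -- the finite-difference identity
  have key : ∀ (z : PhaseSpace N) (t : ℝ),
      (deriv (pinnedChain ω₂ lam β γ).V (z.1 ⟨y.val + 1, hy⟩ - t) -
          deriv (pinnedChain ω₂ lam β γ).V (z.1 ⟨y.val + 1, hy⟩ - z.1 y)) * partialP ⟨y.val + 1, hy⟩ v z =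
        ξ ⟨y.val + 1, hy⟩ * (((pinnedChain ω₂ lam β γ).V (z.1 ⟨y.val + 1, hy⟩ - t) -
          (pinnedChain ω₂ lam β γ).V (z.1 ⟨y.val + 1, hy⟩ - z.1 y)) / 2) := by
    intro z t
    have h1 := hL (update z.1 y t, z.2)
    rw [generator_qVar _ hU hV T_L T_R hy hInv hPle z t, hL z, sum_e_qVar _ he ξ hy hξ z t] at h1
    linarith
  have hC : ∀ z, ξ ⟨y.val + 1, hy⟩ = 0 ∧ partialP ⟨y.val + 1, hy⟩ v z = 0 := by
    intro z
    have h0 := key z (z.1 ⟨y.val + 1, hy⟩)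
    have h1 := key z (z.1 ⟨y.val + 1, hy⟩ - 1)
    have h2 := key z (z.1 ⟨y.val + 1, hy⟩ + 1)
    simp only [sub_sub_cancel, sub_self, pinnedChain_deriv_V, hVdef,
      show ∀ a : ℝ, a - (a + 1) = -1 from fun a => by ring] at h0 h1 h2
    constructor
    · nlinarith
    · have hξ0 : ξ ⟨y.val + 1, hy⟩ = 0 := by nlinarith
      rw [hξ0] at h1 h0
      nlinarith
  by_cases hN : Nonempty (PhaseSpace N)
  · exact ⟨(hC (Classical.choice hN)).1, fun z => (hC z).2⟩
  · exact ⟨(hC (0 : PhaseSpace N)).1, fun z => (hC z).2⟩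

end Stages

/-! ### The theorem -/

/-- **Bracket induction.**  For the pinned chain with `β ≥ 0` (any `ω₂, lam, γ`, any bath temperatures): if a
differentiable `v` with `∂_{p_0} v ≡ 0` solves `L v = -(Σ_x ξ_x e_x - m)` pointwise for the split site energies
`e_x`, then `ξ = 0`.  (The algebraic half of the positivity of `G(0)`: a non-zero energy profile cannot have a
Poisson solution that is invisible to the left bath.) -/
theorem bracketInduction {ω₂ lam β γ T_L T_R : ℝ} (hβ : 0 ≤ β) (hN : 0 < N) {v : PhaseSpace N → ℝ}
    (hv : Differentiable ℝ v) {e : Fin N → PhaseSpace N → ℝ}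
    (he : ∀ x z, e x z = z.2 x ^ 2 / 2 + (pinnedChain ω₂ lam β γ).U (z.1 x) +
      ∑ j : Fin N, ((if j.val = x.val + 1 then (pinnedChain ω₂ lam β γ).V (z.1 j - z.1 x) / 2 else 0) +
        (if x.val = j.val + 1 then (pinnedChain ω₂ lam β γ).V (z.1 x - z.1 j) / 2 else 0)))
    {ξ : Fin N → ℝ} {m : ℝ}
    (hL : ∀ z, (pinnedChain ω₂ lam β γ).generator N T_L T_R v z = -((∑ x, ξ x * e x z) - m))
    (hp0 : ∀ z, partialP ⟨0, hN⟩ v z = 0) : ξ = 0 := by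
  -- claim(k): ξ_k = 0, ∂_{p_k} v ≡ 0, ∂_{q_k} v ≡ 0, for all k < N, by strong induction
  have claim : ∀ k : ℕ, ∀ hk : k < N,
      ξ ⟨k, hk⟩ = 0 ∧ (∀ z, partialP ⟨k, hk⟩ v z = 0) ∧ (∀ z, partialQ ⟨k, hk⟩ v z = 0) := by
    intro k
    induction k using Nat.strong_induction_on with
    | _ k ih =>
      intro hk
      -- first `∂_{p_k} v ≡ 0` and (for `k ≥ 1`) `ξ_k = 0`
      have hpk : ∀ z, partialP ⟨k, hk⟩ v z = 0 := by
        rcases Nat.eq_zero_or_pos k with h0 | hpos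
        · subst h0; exact hp0
        · obtain ⟨y', hy'⟩ : ∃ y', k = y' + 1 := ⟨k - 1, by omega⟩
          subst hy'
          have hyN : y' < N := by omega
          have := stage_q (N := N) hβ hv he hL (y := ⟨y', hyN⟩) hk (ih y' (Nat.lt_succ_self _) hyN).2.2
            (fun i hi z => (ih i.val (by simp only at hi; omega) i.isLt).2.1 z)
            (fun i hi => (ih i.val (by simp only at hi; omega) i.isLt).1)
          exact this.2
      have hst := stage_p hv he hL ⟨k, hk⟩ hpk
      exact ⟨hst.1, hpk, hst.2⟩
  funext x
  exact (claim x.val x.isLt).1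

end OrthogonalOhmLine.BracketInduction

open OrthogonalOhmLine.BracketInduction in
/-- **Stub F3** (`BracketInduction`, line `Sketch`, skeleton v5 of crux `stmt-AtomisticToContinuum-12693`): for the
pinned chain with `β ≥ 0`, a differentiable `v` with `∂_{p_0} v ≡ 0` solving `L v = −(Σ ξ_x e_x − m)` pointwise forces
`ξ = 0` (the registered closed signature; proved by `bracketInduction`). -/
theorem stub_bracketInduction :
    ∀ (N : ℕ) (ω₂ lam β γ T_L T_R : ℝ), 0 ≤ β → ∀ hN : 0 < N,
      ∀ v : Literature.MathematicalPhysics.KineticTheory.HeatConduction.PhaseSpace N → ℝ, Differentiable ℝ v →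
      ∀ e : Fin N → Literature.MathematicalPhysics.KineticTheory.HeatConduction.PhaseSpace N → ℝ,
        (∀ x z, e x z = z.2 x ^ 2 / 2 + (Literature.MathematicalPhysics.KineticTheory.HeatConduction.pinnedChain ω₂ lam β γ).U (z.1 x) +
          ∑ j : Fin N, ((if j.val = x.val + 1 then (Literature.MathematicalPhysics.KineticTheory.HeatConduction.pinnedChain ω₂ lam β γ).V (z.1 j - z.1 x) / 2 else 0) +
            (if x.val = j.val + 1 then (Literature.MathematicalPhysics.KineticTheory.HeatConduction.pinnedChain ω₂ lam β γ).V (z.1 x - z.1 j) / 2 else 0))) →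
      ∀ (ξ : Fin N → ℝ) (m : ℝ),
        (∀ z, (Literature.MathematicalPhysics.KineticTheory.HeatConduction.pinnedChain ω₂ lam β γ).generator N T_L T_R v z =
          -((∑ x, ξ x * e x z) - m)) →
        (∀ z, Literature.MathematicalPhysics.KineticTheory.HeatConduction.partialP ⟨0, hN⟩ v z = 0) → ξ = 0 :=
  fun _N _ω₂ _lam _β _γ _T_L _T_R hβ hN _v hv _e he _ξ _m hL hp0 => bracketInduction hβ hN hv he hL hp0

end Summit.AtomisticToContinuum.FouriersLaw.Theorems.HonestZwanzig
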